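import Literature.NumberTheory.Automorphic.RankinSelbergTorusPointwise
import Literature.NumberTheory.Automorphic.TestFunctionGLLevel
import Literature.NumberTheory.Automorphic.SmoothedCuspFormGeneric
import Literature.NumberTheory.Automorphic.SatakeParameterUnitBound
import Literature.NumberTheory.Automorphic.SiegelSetVolume
import HarnessLib

/-!
# Jacquet–Shalika's (5.3.3)–(5.3.4) off an arbitrary set of places, from the finiteness of the
unfolded Rankin–Selberg integral alone

Topic `NumberTheory/Automorphic`; namespace `Literature.NumberTheory.Automorphic`. Proof file
(theorems only: no definition, no named fact), the leaf of the single-place Rankin–Selberg run of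
`RankinSelbergTorusPointwise`. There the named fact `summable_normSq_trace_satakePow` of
`AutomorphicLFunctionProofs` (Jacquet–Shalika (1981), Thm. (5.3) proof, (5.3.3)–(5.3.4), off an
**arbitrary** `S`) is reduced, for any class of smoothing weights, to three inputs: (hex) non-zero
smoothings of prescribed level, (hZ) genericity, (hfin) finiteness of the unfolded integral. For the
class of **test functions** (`IsTestFunctionGL`) the first two are theorems of the tree —
`exists_isTestFunctionGL_level_smoothedForm_ne_zero` (`TestFunctionGLLevel`) and
`exists_whittakerCoeff_invQuot_smoothedForm_ne_zero_of_one_le` (`SmoothedCuspFormGeneric`: cusp forms on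
`GL_n` are generic, Shalika (1974) / Piatetski-Shapiro) — so that the fact, its large-finite-`S` part
`JacquetShalika1981_schurSelfSum_prod_bounded` and the bound (5.1.3) `norm_satakeParameter_le_sqrt`
follow from the single remaining analytic input of Jacquet–Shalika's §4:

(hfin) for every cuspidal `Π`, every test function `η`, every `f ∈ Π` and every `σ > 1`, the unfolded
Rankin–Selberg integral `Ψ(σ; W_φ, W̄_φ, Φ_∞ ⊗ 𝟙_{𝒪̂ⁿ})` of the Whittaker coefficient (Tate's
character and box) of `φ = invQuot (S_η f)` is finite — the hypothesis of
`JacquetShalika1981_schurSelfSum_prod_bounded_of_rankinSelbergTorusIntegral_ne_top`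
(`JacquetShalikaSchurSelfSumOfTorusFiniteness`, which asks it for all `f ∈ L²_cusp`), to be supplied
by the unfolding inequality over the Whittaker tower (`WhittakerTowerChain`) and the finiteness of
`∫ |φ|² E(·, Φ; σ)` (`RankinSelbergSiegelFiniteness`, `GLnCuspidalSiegelDecay`).

* `jacquetShalika1981_schurSelfSum_prod_bounded_of_finite_rankinSelberg` — (hfin) ⇒ (J);
* `schurSelfSum_ne_top_of_finite_rankinSelberg` — (hfin at `σ`) ⇒ `T_v(q_v^{-σ}) < ∞` at every
  unramified `v` (`1 ≤ n`);
* `summable_normSq_trace_satakePow_of_finite_rankinSelberg` — **(hfin) ⇒ the named fact**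
  (`n = 0` by `summable_normSq_trace_satakePow_of_le_one`);
* `norm_satakeParameter_le_sqrt_of_finite_rankinSelberg` — (hfin) ⇒ (5.1.3).

Measurable structures as in `JacquetShalikaSchurSelfSumOfTorusFiniteness`: the tree's Borel structures
`adelicBorel` on `(AdelicGroupData.gl n K).Adelic` and `glAdeleBorel` on the definitionally equal
`GL (Fin n) (AdeleRing (𝓞 K) K)` (local instances, both `borel _`), the Borel structure of `𝔸_Kˣ` as an
instance argument, `N_n(𝔸_K)` with the subtype structure.

## References

* H. Jacquet, J. A. Shalika, *On Euler products and the classification of automorphic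
  representations I*, Amer. J. Math. 103 (1981), 499–558: §4; (5.1.3) p. 554; Lemma (5.2) p. 554;
  Thm. (5.3) p. 555, proof (5.3.3)–(5.3.4) p. 556 [JacquetShalikaAJM1981].
* J. A. Shalika, *The multiplicity one theorem for GL_n*, Ann. of Math. 100 (1974), Thm. 5.9
  [Shalika1974].
-/

noncomputable section

open MeasureTheory Measure NumberField IsDedekindDomain Matrix Set Filter Finset
open scoped MatrixGroups ENNReal NNReal ComplexConjugate Pointwise
open Literature.RingTheory.SymmetricFunctions.SymmPoly
open Literature.NumberTheory.GaloisRepresentations (ideleGroup localUnits)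

namespace Literature.NumberTheory.Automorphic

section TestFunction

variable {n : ℕ} {K : Type} [Field K] [NumberField K]
  {μ : Measure (AdelicGroupData.gl n K).automorphicQuotient}
  [(AdelicGroupData.gl n K).IsAutomorphicMeasure μ]
variable [MeasurableSpace (ideleGroup K)] [BorelSpace (ideleGroup K)]

-- Borel structures: the tree's `adelicBorel n K` on `(AdelicGroupData.gl n K).Adelic` (the spelling
-- of `RankinSelbergTorusIntegral`) and `glAdeleBorel n K` of `SiegelSetVolume` on the definitionally
-- equal `GL (Fin n) (AdeleRing (𝓞 K) K)` (the spelling of the Whittaker tower files, for `N_n(𝔸_K)` and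
-- genericity), exactly as in `JacquetShalikaSchurSelfSumOfTorusFiniteness`; both are `borel _`.
attribute [local instance] adelicBorel borelSpace_adelic locallyCompactSpace_adelic
  secondCountableTopology_gl_adelic secondCountableTopology_ideleGroup glAdeleBorel borelSpace_glAdele

/-- **(J) from the finiteness of the unfolded Rankin–Selberg integral alone.** If for every cuspidal
`Π`, every test function `η` (`IsTestFunctionGL`: smooth at infinity, of finite level, compactly
supported), every `f ∈ Π` and every `σ > 1` the unfolded Rankin–Selberg integral
`Ψ(σ; W_φ, W̄_φ, Φ_∞ ⊗ 𝟙_{𝒪̂ⁿ})` of the Whittaker coefficient `W_φ` of `φ = invQuot (S_η f)` (Tate's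
character and box, a Haar measure `ν` on `N_n(𝔸_K)`) is finite, then
`JacquetShalika1981_schurSelfSum_prod_bounded` holds: genericity (hZ) is the theorem
`exists_whittakerCoeff_invQuot_smoothedForm_ne_zero_of_one_le` of `SmoothedCuspFormGeneric` (cusp
forms on `GL_n` are generic, Shalika / Piatetski-Shapiro), and test-function smoothings of
prescribed level exist (`exists_isTestFunctionGL_level_smoothedForm_ne_zero`, `TestFunctionGLLevel`);
`n = 0` is trivial (`summable_normSq_trace_satakePow_of_le_one`). Measurable structures as in
`JacquetShalikaSchurSelfSumOfTorusFiniteness` (whose hypothesis, quantified over `f ∈ L²_cusp`,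
implies the present one). [cite: JacquetShalikaAJM1981, Lemma (5.2), Thm. (5.3) proof, (5.3.3)–(5.3.4)] -/
theorem jacquetShalika1981_schurSelfSum_prod_bounded_of_finite_rankinSelberg
    (ν : Measure ↥(adelicUnipotent n K)) [IsHaarMeasure ν]
    {Φinf : (Fin n → InfiniteAdeleRing K) → ℝ} (hΦc : Continuous Φinf) (hΦpos : ∀ z, 0 < Φinf z)
    (νA : Measure (Fin n → ideleGroup K)) [νA.IsMulLeftInvariant] [SFinite νA] [νA.IsOpenPosMeasure]
    (νK : Measure ↥(maximalCompactAdelic n K)) [SFinite νK] [νK.IsOpenPosMeasure]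
    (hfin : ∀ (P : CuspidalAutomorphicRepGL n K μ) {η : (AdelicGroupData.gl n K).Adelic → ℝ},
      IsTestFunctionGL n K η → ∀ f : P.1.toSubmodule, ∀ ⦃σ : ℝ⦄, 1 < σ →
        rankinSelbergTorusIntegral n K νA νK
          (whittakerCoeff ν (unipotentTateDomain n K) (adeleAddChar K)
            (invQuot (AdelicGroupData.gl n K) (smoothedForm η (f : (AdelicGroupData.gl n K).L2 μ))))
          (standardTestFun n K Φinf) σ ≠ ⊤) :
    JacquetShalika1981_schurSelfSum_prod_bounded (μ := μ) := by
  rcases Nat.lt_or_ge n 1 with hn | hn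
  · exact JacquetShalika1981_schurSelfSum_prod_bounded_of_largeFinset
      (summable_normSq_trace_largeFinset_of_summable (summable_normSq_trace_satakePow_of_le_one (by omega)))
  · exact jacquetShalika1981_schurSelfSum_prod_bounded_of_rankinSelberg_of_weights (IsTestFunctionGL n K) ν
      hΦc hΦpos νA νK
      (fun P 𝔫 h𝔫 f hfK hf0 => by
        obtain ⟨η, hη, -, hηK, hne⟩ := exists_isTestFunctionGL_level_smoothedForm_ne_zero P.1 h𝔫 hfK hf0
        exact ⟨η, hη, hη.continuous, hη.hasCompactSupport, hηK, hne⟩)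
      (fun P η _ hη hηs f hf => by
        letI : MeasurableSpace (AdeleRing (𝓞 K) K) := borel _
        haveI : BorelSpace (AdeleRing (𝓞 K) K) := ⟨rfl⟩
        exact exists_whittakerCoeff_invQuot_smoothedForm_ne_zero_of_one_le hn hη hηs
          (P.le_cuspidalSubspace f.2) hf ν)
      (fun P η hPη _ _ f _ hσ => hfin P hPη f hσ)

/-- **The torus sum at a single unramified place from the finiteness of the unfolded integral
alone** (`schurSelfSum_ne_top_of_rankinSelberg_of_weights` for test functions, genericity
discharged): for `1 ≤ n`, `T_v(q_v^{-σ}) < ∞` at every `v ∉ S` as soon as the unfolded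
Rankin–Selberg integrals of the test-function smoothings of `Π` are finite at `σ`.
[cite: JacquetShalikaAJM1981, §2 Prop. (2.3), §4, Thm. (5.3) proof] -/
theorem schurSelfSum_ne_top_of_finite_rankinSelberg (hn : 1 ≤ n) (P : CuspidalAutomorphicRepGL n K μ)
    {S : Set (HeightOneSpectrum (𝓞 K))} {α : SatakeFamily K} (hα : IsSatakeFamilyOf P S α)
    {v : HeightOneSpectrum (𝓞 K)} (hv : v ∉ S) {x : Fin n → ℂ}
    (hx : (Finset.univ : Finset (Fin n)).val.map x = α v) {σ : ℝ}
    (ν : Measure ↥(adelicUnipotent n K)) [IsHaarMeasure ν]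
    {Φinf : (Fin n → InfiniteAdeleRing K) → ℝ} (hΦc : Continuous Φinf) (hΦpos : ∀ z, 0 < Φinf z)
    (νA : Measure (Fin n → ideleGroup K)) [νA.IsMulLeftInvariant] [SFinite νA] [νA.IsOpenPosMeasure]
    (νK : Measure ↥(maximalCompactAdelic n K)) [SFinite νK] [νK.IsOpenPosMeasure]
    (hfin : ∀ {η : (AdelicGroupData.gl n K).Adelic → ℝ}, IsTestFunctionGL n K η →
      ∀ f : P.1.toSubmodule, rankinSelbergTorusIntegral n K νA νK
        (whittakerCoeff ν (unipotentTateDomain n K) (adeleAddChar K)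
          (invQuot (AdelicGroupData.gl n K) (smoothedForm η (f : (AdelicGroupData.gl n K).L2 μ))))
        (standardTestFun n K Φinf) σ ≠ ⊤) :
    schurSelfSum x ((v.residueCard : ℝ) ^ (-σ)) ≠ ⊤ :=
  schurSelfSum_ne_top_of_rankinSelberg_of_weights (IsTestFunctionGL n K) P hα hv hx ν hΦc hΦpos νA νK
    (fun h𝔫 f hfK hf0 => by
      obtain ⟨η, hη, -, hηK, hne⟩ := exists_isTestFunctionGL_level_smoothedForm_ne_zero P.1 h𝔫 hfK hf0
      exact ⟨η, hη, hη.continuous, hη.hasCompactSupport, hηK, hne⟩)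
    (fun _ hη hηs f hf => by
      letI : MeasurableSpace (AdeleRing (𝓞 K) K) := borel _
      haveI : BorelSpace (AdeleRing (𝓞 K) K) := ⟨rfl⟩
      exact exists_whittakerCoeff_invQuot_smoothedForm_ne_zero_of_one_le hn hη hηs
        (P.le_cuspidalSubspace f.2) hf ν)
    (fun hPη _ _ f => hfin hPη f)

/-- **`summable_normSq_trace_satakePow` (Jacquet–Shalika's (5.3.3)–(5.3.4) off an arbitrary `S`)
from the finiteness of the unfolded Rankin–Selberg integral alone.** If for every cuspidal `Π` of
`GL_n(𝔸_K)`, every test function `η`, every `f ∈ Π` and every `σ > 1` the unfolded Rankin–Selberg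
integral `Ψ(σ; W_φ, W̄_φ, Φ_∞ ⊗ 𝟙_{𝒪̂ⁿ})`, `φ = invQuot (S_η f)`, is finite (Jacquet–Shalika (1981),
§4: `∫ |φ|² E(·, Φ; σ) < ∞` for `σ > 1`, and unfolding), then the named fact holds — the large-`S`
part by `jacquetShalika1981_schurSelfSum_prod_bounded_of_finite_rankinSelberg` and the pointwise part
by `schurSelfSum_ne_top_of_finite_rankinSelberg`; `n = 0` by `summable_normSq_trace_satakePow_of_le_one`.
[cite: JacquetShalikaAJM1981, Thm. (5.3) proof, (5.3.3)–(5.3.4), (5.1.3)] -/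
theorem summable_normSq_trace_satakePow_of_finite_rankinSelberg
    (ν : Measure ↥(adelicUnipotent n K)) [IsHaarMeasure ν]
    {Φinf : (Fin n → InfiniteAdeleRing K) → ℝ} (hΦc : Continuous Φinf) (hΦpos : ∀ z, 0 < Φinf z)
    (νA : Measure (Fin n → ideleGroup K)) [νA.IsMulLeftInvariant] [SFinite νA] [νA.IsOpenPosMeasure]
    (νK : Measure ↥(maximalCompactAdelic n K)) [SFinite νK] [νK.IsOpenPosMeasure]
    (hfin : ∀ (P : CuspidalAutomorphicRepGL n K μ) {η : (AdelicGroupData.gl n K).Adelic → ℝ},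
      IsTestFunctionGL n K η → ∀ f : P.1.toSubmodule, ∀ ⦃σ : ℝ⦄, 1 < σ →
        rankinSelbergTorusIntegral n K νA νK
          (whittakerCoeff ν (unipotentTateDomain n K) (adeleAddChar K)
            (invQuot (AdelicGroupData.gl n K) (smoothedForm η (f : (AdelicGroupData.gl n K).L2 μ))))
          (standardTestFun n K Φinf) σ ≠ ⊤) :
    summable_normSq_trace_satakePow (μ := μ) := by
  rcases Nat.lt_or_ge n 1 with hn | hn
  · exact summable_normSq_trace_satakePow_of_le_one (by omega)
  · exact summable_normSq_trace_satakePow_iff_schurSelfSum_prod_bounded_and_ne_top.2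
      ⟨jacquetShalika1981_schurSelfSum_prod_bounded_of_finite_rankinSelberg ν hΦc hΦpos νA νK hfin,
        fun P _ _ hα _ hv _ hx _ hσ => schurSelfSum_ne_top_of_finite_rankinSelberg hn P hα hv hx ν hΦc
          hΦpos νA νK (fun hη f => hfin P hη f hσ)⟩

/-- Hence also **(5.1.3)** `norm_satakeParameter_le_sqrt` from the finiteness of the unfolded
Rankin–Selberg integral alone. [cite: JacquetShalikaAJM1981, (5.1.3) p. 554] -/
theorem norm_satakeParameter_le_sqrt_of_finite_rankinSelberg
    (ν : Measure ↥(adelicUnipotent n K)) [IsHaarMeasure ν]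
    {Φinf : (Fin n → InfiniteAdeleRing K) → ℝ} (hΦc : Continuous Φinf) (hΦpos : ∀ z, 0 < Φinf z)
    (νA : Measure (Fin n → ideleGroup K)) [νA.IsMulLeftInvariant] [SFinite νA] [νA.IsOpenPosMeasure]
    (νK : Measure ↥(maximalCompactAdelic n K)) [SFinite νK] [νK.IsOpenPosMeasure]
    (hfin : ∀ (P : CuspidalAutomorphicRepGL n K μ) {η : (AdelicGroupData.gl n K).Adelic → ℝ},
      IsTestFunctionGL n K η → ∀ f : P.1.toSubmodule, ∀ ⦃σ : ℝ⦄, 1 < σ →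
        rankinSelbergTorusIntegral n K νA νK
          (whittakerCoeff ν (unipotentTateDomain n K) (adeleAddChar K)
            (invQuot (AdelicGroupData.gl n K) (smoothedForm η (f : (AdelicGroupData.gl n K).L2 μ))))
          (standardTestFun n K Φinf) σ ≠ ⊤) :
    norm_satakeParameter_le_sqrt (μ := μ) :=
  norm_satakeParameter_le_sqrt_of_summable
    (summable_normSq_trace_satakePow_of_finite_rankinSelberg ν hΦc hΦpos νA νK hfin)

/-- **The named fact `summable_normSq_trace_satakePow` from the hypothesis `hfin` of
`JacquetShalika1981_schurSelfSum_prod_bounded_of_rankinSelbergTorusIntegral_ne_top`**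
(`JacquetShalikaSchurSelfSumOfTorusFiniteness`; quantified over all `f ∈ L²_cusp`), in every rank —
the form in which the real-point Rankin–Selberg programme states its remaining input
(`AutomorphicLFunctionOfTorusFiniteness`). [cite: JacquetShalikaAJM1981, Thm. (5.3) proof, (5.3.3)–(5.3.4)] -/
theorem summable_normSq_trace_satakePow_of_rankinSelbergTorusIntegral_ne_top
    (νA : Measure (Fin n → ideleGroup K)) [νA.IsMulLeftInvariant] [SFinite νA] [νA.IsOpenPosMeasure]
    (νK : Measure ↥(maximalCompactAdelic n K)) [SFinite νK] [νK.IsOpenPosMeasure]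
    (ν₀ : Measure ↥(adelicUnipotent n K)) [IsHaarMeasure ν₀]
    {Φinf : (Fin n → InfiniteAdeleRing K) → ℝ} (hΦc : Continuous Φinf) (hΦ : ∀ z, 0 < Φinf z)
    (hfin : ∀ (η : (AdelicGroupData.gl n K).Adelic → ℝ), IsTestFunctionGL n K η →
      ∀ (f : (AdelicGroupData.gl n K).L2 μ), f ∈ cuspidalSubspace n K μ → ∀ ⦃σ : ℝ⦄, 1 < σ →
        rankinSelbergTorusIntegral n K νA νK
          (whittakerCoeff ν₀ (unipotentTateDomain n K) (adeleAddChar K)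
            (invQuot (AdelicGroupData.gl n K) (smoothedForm η f)))
          (standardTestFun n K Φinf) σ ≠ ⊤) :
    summable_normSq_trace_satakePow (μ := μ) :=
  summable_normSq_trace_satakePow_of_finite_rankinSelberg ν₀ hΦc hΦ νA νK
    (fun P η hη f _ hσ => hfin η hη _ (P.le_cuspidalSubspace f.2) hσ)

/-- Likewise **(5.1.3)** `norm_satakeParameter_le_sqrt` from the same `hfin`.
[cite: JacquetShalikaAJM1981, (5.1.3) p. 554] -/
theorem norm_satakeParameter_le_sqrt_of_rankinSelbergTorusIntegral_ne_top
    (νA : Measure (Fin n → ideleGroup K)) [νA.IsMulLeftInvariant] [SFinite νA] [νA.IsOpenPosMeasure]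
    (νK : Measure ↥(maximalCompactAdelic n K)) [SFinite νK] [νK.IsOpenPosMeasure]
    (ν₀ : Measure ↥(adelicUnipotent n K)) [IsHaarMeasure ν₀]
    {Φinf : (Fin n → InfiniteAdeleRing K) → ℝ} (hΦc : Continuous Φinf) (hΦ : ∀ z, 0 < Φinf z)
    (hfin : ∀ (η : (AdelicGroupData.gl n K).Adelic → ℝ), IsTestFunctionGL n K η →
      ∀ (f : (AdelicGroupData.gl n K).L2 μ), f ∈ cuspidalSubspace n K μ → ∀ ⦃σ : ℝ⦄, 1 < σ →
        rankinSelbergTorusIntegral n K νA νK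
          (whittakerCoeff ν₀ (unipotentTateDomain n K) (adeleAddChar K)
            (invQuot (AdelicGroupData.gl n K) (smoothedForm η f)))
          (standardTestFun n K Φinf) σ ≠ ⊤) :
    norm_satakeParameter_le_sqrt (μ := μ) :=
  norm_satakeParameter_le_sqrt_of_summable
    (summable_normSq_trace_satakePow_of_rankinSelbergTorusIntegral_ne_top νA νK ν₀ hΦc hΦ hfin)

end TestFunction

end Literature.NumberTheory.Automorphic
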